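import Summits.HodgeConjecture.Ring2.NonCMFivefoldsCodimTwoResidual
import Summits.HodgeConjecture.Ring2.EndAlgebraDegreeEightEvenMultiplicity
import HarnessLib

/-!
# Ring 2 (cell topic `Summits/HodgeConjecture/Ring2/`; seat `lit`, gen 65, H9): the residual of the fivefold fact `MoonenZarhin1999_codimTwoHodgeClasses_abelianFivefold` — the quaternion-over-`k` cell of case (g) is EMPTY; case (g) remains only for `End⁰(F)` a QUARTIC FIELD

HONEST FRAMING (cell `pub-hodge-ring2`, verbatim): research route conditional on HC_CM; not a corollary;
Q11.4-sentence-2 already refuted in dim ≥ 3. `HC_CM` does NOT occur in this file, nor does Markman's theorem;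
everything is UNCONDITIONAL (Tankeev–Ribet is a HYPOTHESIS of one theorem). Theorems only — no definition, no named
fact, no `sorry`. No case of the Hodge conjecture is claimed.

THE PRINT. B. Moonen, Yu. Zarhin, Math. Ann. **315** (1999), Thm. 0.2 case (g) «`X₂` a simple abelian fourfold such
that there exists an embedding `k ↪ End⁰(X₂)` via which `k` acts on `T_{X₂,0}` with multiplicities `(1,3)`», §5 (5.10)
«Finally, let us assume that `d_max = 4`, i.e., that `Y` is simple (of Type 4). Write `k = End⁰(E)` and `F = End⁰(Y)` …
Case 2: Suppose that `k` acts on `T_{Y,0}` with multiplicities `(1,3)`. (By [Shimura], Proposition 14 this is the only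
other case that occurs.)»; §1 (1.1) «Type 4(e₀,d): … `D` is a division algebra of rank `d²` over `F`».

THIS FILE.  The companion `NonCMFivefoldsCodimTwoResidual.moonenZarhin1999_codimTwoHodgeClasses_abelianFivefold_iff_residual_albert`
reads the non-CM residual of case (g) in Albert's table as: `F` a simple non-CM fourfold with a CENTRAL unbalanced `φ`,
`φ ≫ φ = -(M²d')`, and `End⁰(F)` EITHER a quartic field OR of degree `8` with centre of degree `2` (a quaternion algebra
over `k = ℚ(φ)`, Albert's `d = 2`).  The second alternative is EMPTY: by the Literature lane's
`EndAlgebraDegreeEightEvenMultiplicity` (Wedderburn blocks of `End⁰(F) ⊗ ℂ` acting on `H¹` are all `M₂(ℂ)`) a central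
`φ` then acts on `H^{1,0}(F)` with EVEN multiplicities, while on a simple fourfold an unbalanced `φ` acts with
multiplicities `(1,3)` (Shimura's Prop. 14, the tree's `AbelianVariety.eigenMultiplicity_pos_of_isSimple`, sum `4`).
* §1 `eigenMultiplicity_eq_of_isSimple_of_dim_eq_four_of_finrank_eq_eight` — `[End⁰(F):ℚ] = 8`, `[Z:ℚ] = 2`, `F` simple
  of dimension `4`, `φ` central with `φ ≫ φ = -d` ⟹ the two multiplicities are EQUAL (`(2,2)`);
  `not_quaternionCell` — the `d = 2` cell of (γ) is empty.
* §2 **`moonenZarhin1999_codimTwoHodgeClasses_abelianFivefold_iff_residual_quartic`** — THE FIVEFOLD FACT is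
  EQUIVALENT to its instances at (α) the simple fivefolds NOT of CM type [Tankeev–Ribet]; (β) case (e) ∩ (a1)
  [Thm. 0.2 (1)]; (γ') case (g) with `X ∼ F × C`, `C` an elliptic curve with `χ ≫ χ = -d'`, `F` a simple fourfold NOT of
  CM type whose endomorphism algebra IS A QUARTIC FIELD (Type IV(2,1) `⊋ k`), carrying a central `φ`,
  `φ ≫ φ = -(M²d')`, of unbalanced multiplicities [Thm. 0.2 (3) with `End⁰(X₂) ⊋ k`];
  `…_quartic_of_tankeevRibet` — granted Tankeev–Ribet, ↔ (β) ∧ (γ').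

WHAT IS NOT CLAIMED: the fact is NOT discharged; (β) and (γ') are exactly the non-CM rows of Thm. 0.2 (1) and (3) the tree
has not proved; nothing on `B² ≠ D²`; nothing on which algebras occur as `End⁰` of a simple fourfold.

## References
* [MoonenZarhin1999LowDim] B. Moonen, Yu. Zarhin, Math. Ann. 315 (1999) 711–733, Thm. 0.2 (1), (3), cases (e), (g),
  §1 (1.1), §2 (2.4), §5 (5.10) Case 2, (5.11)–(5.12).
* [MumfordAV1970] D. Mumford, *Abelian Varieties* (1970), §19 Cor. 2, §21 (pp. 201–202).
* [Ribet1983] K. A. Ribet, Amer. J. Math. 105 (1983) (with Tankeev: simple abelian varieties of prime dimension).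
-/

noncomputable section

open CategoryTheory CategoryTheory.Limits

namespace Summit.HodgeConjecture.Ring2.NonCMFivefoldsCodimTwoResidualQuartic

open Literature.AlgebraicGeometry.Motives (AbelianVariety)
open Literature.AlgebraicGeometry.Motives.AbelianVariety
open Literature.AlgebraicGeometry.HodgeTheory
open Literature.AlgebraicGeometry.Milne1999 (IsOfCMType)
open Summit.HodgeConjecture.Ring2.CMFivefoldsCodimTwo
open Summit.HodgeConjecture.Ring2.NonCMFivefoldsCodimTwoResidual
open Summit.HodgeConjecture.Ring2.EndAlgebraDegreeEightEvenMultiplicity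

/-! ### §1 A quaternion algebra over the centre forces balanced multiplicities on a simple fourfold -/

/-- **No `(1,3)` under a quaternion algebra over `k`.** On a SIMPLE fourfold `F` with `[End⁰(F):ℚ] = 8` and centre of
degree `2`, a CENTRAL `φ` with `φ ≫ φ = -d` (`d > 0`) acts on `H^{1,0}(F)` with EQUAL multiplicities: both are even
(`even_eigenMultiplicity_of_isSimple_of_finrank_eq_eight_of_finrank_center_eq_two`), positive (Shimura, the tree's
`AbelianVariety.eigenMultiplicity_pos_of_isSimple`) and sum to `4`. [cite: MoonenZarhin1999LowDim, §5 (5.10) Case 2 and §1 (1.1)]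
[cite: MumfordAV1970, §19 Cor. 2 and §21 (pp. 201–202)] -/
theorem eigenMultiplicity_eq_of_isSimple_of_dim_eq_four_of_finrank_eq_eight {F : AbelianVariety ℂ} (hFs : F.IsSimple)
    (hF4 : F.dim = 4) (h8 : Module.finrank ℚ F.endAlgebra = 8)
    (hZ2 : Module.finrank ℚ ↥(Subalgebra.center ℚ F.endAlgebra) = 2) (φ : F ⟶ F) {d : ℕ} (hd : 0 < d)
    (hφ : φ ≫ φ = -(d • 𝟙 F)) (hφZ : AbelianVariety.endAlgebra.of F φ ∈ Subalgebra.center ℚ F.endAlgebra) :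
    eigenMultiplicity F φ (Complex.I * (Real.sqrt d : ℂ)) = eigenMultiplicity F φ (-(Complex.I * (Real.sqrt d : ℂ))) := by
  have hsum := eigenMultiplicity_add_eigenMultiplicity_neg_eq_dim F φ hd hφ
  obtain ⟨ha, hb⟩ := AbelianVariety.eigenMultiplicity_pos_of_isSimple F hFs φ hd hφ (by omega)
  obtain ⟨a, ha2⟩ := even_eigenMultiplicity_of_isSimple_of_finrank_eq_eight_of_finrank_center_eq_two hFs h8 hZ2 hφZ
    (Complex.I * (Real.sqrt d : ℂ))
  obtain ⟨b, hb2⟩ := even_eigenMultiplicity_of_isSimple_of_finrank_eq_eight_of_finrank_center_eq_two hFs h8 hZ2 hφZ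
    (-(Complex.I * (Real.sqrt d : ℂ)))
  omega

/-- **The quaternion-over-`k` cell of (γ) is EMPTY**: no simple fourfold `F` with `[End⁰(F):ℚ] = 8`, centre of degree
`2`, carries a central `φ`, `φ ≫ φ = -(M²d')`, of UNBALANCED multiplicities. [cite: MoonenZarhin1999LowDim, §5 (5.10) Case 2]
[cite: MumfordAV1970, §21 (pp. 201–202)] -/
theorem not_quaternionCell {F : AbelianVariety ℂ} (hFs : F.IsSimple) (hF4 : F.dim = 4)
    (h8 : Module.finrank ℚ F.endAlgebra = 8) (hZ2 : Module.finrank ℚ ↥(Subalgebra.center ℚ F.endAlgebra) = 2)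
    {φ : F ⟶ F} {M d' : ℕ} (hM : 0 < M) (hd' : 0 < d') (hφ : φ ≫ φ = -((M * M * d') • 𝟙 F))
    (hφZ : AbelianVariety.endAlgebra.of F φ ∈ Subalgebra.center ℚ F.endAlgebra)
    (hneq : eigenMultiplicity F φ (Complex.I * (Real.sqrt (M * M * d' : ℕ) : ℂ)) ≠
      eigenMultiplicity F φ (-(Complex.I * (Real.sqrt (M * M * d' : ℕ) : ℂ)))) : False :=
  hneq (eigenMultiplicity_eq_of_isSimple_of_dim_eq_four_of_finrank_eq_eight hFs hF4 h8 hZ2 φ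
    (Nat.mul_pos (Nat.mul_pos hM hM) hd') hφ hφZ)

/-! ### §2 The residual: case (g) only for a quartic field -/

/-- **LOCALISATION OF THE NAMED FACT, QUARTIC FORM.** `MoonenZarhin1999_codimTwoHodgeClasses_abelianFivefold` is
EQUIVALENT to its instances at: (α) the SIMPLE fivefolds NOT of CM type [Tankeev–Ribet]; (β) case (e) ∩ (a1) —
`X ∼ E × (E × T)`, `E` a CM elliptic curve, `T` a simple threefold NOT of CM type with `dim_ℚ End⁰(T) = 2` and
`End⁰(E) ↪ End⁰(T)` [Thm. 0.2 (1)]; (γ') case (g) with `X ∼ F × C`, `C` an elliptic curve with `χ ≫ χ = -d'`, `F` a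
simple fourfold NOT of CM type whose endomorphism algebra is a QUARTIC FIELD (Type IV(2,1) `⊋ k`), a CENTRAL `φ` on
`F` with `φ ≫ φ = -(M²d')` of unbalanced multiplicities, `dim_ℚ End⁰(F) ≠ 2` [Thm. 0.2 (3) with `End⁰(X₂) ⊋ k`] — the
quaternion alternative of the Albert reading being empty (`not_quaternionCell`).
[cite: MoonenZarhin1999LowDim, Thm. 0.2 (1)–(4), §2 (2.4) and §5 (5.1), (5.10)–(5.12)] [cite: MumfordAV1970, §21 (pp. 201–202)] -/
theorem moonenZarhin1999_codimTwoHodgeClasses_abelianFivefold_iff_residual_quartic :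
    MoonenZarhin1999_codimTwoHodgeClasses_abelianFivefold ↔
      (∀ A : AbelianVariety ℂ, A.dim = 5 → A.IsSimple → ¬ IsOfCMType A → IsCodimTwoDivisorPullbackGenerated A) ∧
      (∀ A : AbelianVariety ℂ, A.dim = 5 →
        (∃ E T : AbelianVariety ℂ, E.dim = 1 ∧ IsOfCMType E ∧ T.IsSimple ∧ T.dim = 3 ∧
          Module.finrank ℚ T.endAlgebra = 2 ∧ ¬ IsOfCMType T ∧
          Nonempty (E.endAlgebra →+* T.endAlgebra) ∧ AbelianVariety.IsIsogenous A (E.prod (E.prod T))) →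
        IsCodimTwoDivisorPullbackGenerated A) ∧
      (∀ A : AbelianVariety ℂ, A.dim = 5 →
        (∃ (F C : AbelianVariety ℂ), F.IsSimple ∧ F.dim = 4 ∧ ¬ IsOfCMType F ∧
          (IsField F.endAlgebra ∧ Module.finrank ℚ F.endAlgebra = 4) ∧
          C.dim = 1 ∧ AbelianVariety.IsIsogenous A (F.prod C) ∧
          ∃ (χ : C ⟶ C) (d' : ℕ), 0 < d' ∧ χ ≫ χ = -(d' • 𝟙 C) ∧ ∃ (φ : F ⟶ F) (M : ℕ), 0 < M ∧
          φ ≫ φ = -((M * M * d') • 𝟙 F) ∧ AbelianVariety.endAlgebra.of F φ ∈ Subalgebra.center ℚ F.endAlgebra ∧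
          eigenMultiplicity F φ (Complex.I * (Real.sqrt (M * M * d' : ℕ) : ℂ)) ≠
            eigenMultiplicity F φ (-(Complex.I * (Real.sqrt (M * M * d' : ℕ) : ℂ))) ∧
          Module.finrank ℚ F.endAlgebra ≠ 2) →
        IsCodimTwoDivisorPullbackGenerated A) := by
  rw [moonenZarhin1999_codimTwoHodgeClasses_abelianFivefold_iff_residual_albert]
  refine ⟨fun ⟨hS, hE, hG⟩ => ⟨hS, hE, fun A hA ⟨F, C, hFs, hF4, hF, hK, hrest⟩ =>
      hG A hA ⟨F, C, hFs, hF4, hF, Or.inl hK, hrest⟩⟩, fun ⟨hS, hE, hG⟩ => ⟨hS, hE, ?_⟩⟩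
  rintro A hA ⟨F, C, hFs, hF4, hF, hK | ⟨h8, hZ2⟩, hC, hAFC, χ, d', hd', hχ, φ, M, hM, hφ, hφZ, hneq, h2⟩
  · exact hG A hA ⟨F, C, hFs, hF4, hF, hK, hC, hAFC, χ, d', hd', hχ, φ, M, hM, hφ, hφZ, hneq, h2⟩
  · exact (not_quaternionCell hFs hF4 h8 hZ2 hM hd' hφ hφZ hneq).elim

/-- **GRANTED THE TANKEEV–RIBET FACT** (HYPOTHESIS `TankeevRibet1983_hodgeClasses_divisorial_powers_simplePrimeDimension`),
the fivefold fact is EQUIVALENT to its instances at case (e) ∩ (a1) and at case (g) with `End⁰(F)` a quartic field,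
`F` not of CM type. [cite: MoonenZarhin1999LowDim, Thm. 0.2 (1), (3) and §2 Thm. (2.7)] [cite: Ribet1983, Thm. 3] -/
theorem moonenZarhin1999_codimTwoHodgeClasses_abelianFivefold_iff_residual_quartic_of_tankeevRibet
    (hTR : TankeevRibet1983_hodgeClasses_divisorial_powers_simplePrimeDimension) :
    MoonenZarhin1999_codimTwoHodgeClasses_abelianFivefold ↔
      (∀ A : AbelianVariety ℂ, A.dim = 5 →
        (∃ E T : AbelianVariety ℂ, E.dim = 1 ∧ IsOfCMType E ∧ T.IsSimple ∧ T.dim = 3 ∧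
          Module.finrank ℚ T.endAlgebra = 2 ∧ ¬ IsOfCMType T ∧
          Nonempty (E.endAlgebra →+* T.endAlgebra) ∧ AbelianVariety.IsIsogenous A (E.prod (E.prod T))) →
        IsCodimTwoDivisorPullbackGenerated A) ∧
      (∀ A : AbelianVariety ℂ, A.dim = 5 →
        (∃ (F C : AbelianVariety ℂ), F.IsSimple ∧ F.dim = 4 ∧ ¬ IsOfCMType F ∧
          (IsField F.endAlgebra ∧ Module.finrank ℚ F.endAlgebra = 4) ∧
          C.dim = 1 ∧ AbelianVariety.IsIsogenous A (F.prod C) ∧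
          ∃ (χ : C ⟶ C) (d' : ℕ), 0 < d' ∧ χ ≫ χ = -(d' • 𝟙 C) ∧ ∃ (φ : F ⟶ F) (M : ℕ), 0 < M ∧
          φ ≫ φ = -((M * M * d') • 𝟙 F) ∧ AbelianVariety.endAlgebra.of F φ ∈ Subalgebra.center ℚ F.endAlgebra ∧
          eigenMultiplicity F φ (Complex.I * (Real.sqrt (M * M * d' : ℕ) : ℂ)) ≠
            eigenMultiplicity F φ (-(Complex.I * (Real.sqrt (M * M * d' : ℕ) : ℂ))) ∧
          Module.finrank ℚ F.endAlgebra ≠ 2) →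
        IsCodimTwoDivisorPullbackGenerated A) := by
  rw [moonenZarhin1999_codimTwoHodgeClasses_abelianFivefold_iff_residual_quartic]
  refine ⟨fun h => ⟨h.2.1, h.2.2⟩, fun h => ⟨fun A hA hs _ => ?_, h.1, h.2⟩⟩
  exact (isDivisorGenerated_powSucc_of_tankeevRibet hTR A (by norm_num : (5 : ℕ).Prime) hA hs 0)
    |>.isCodimTwoDivisorPullbackGenerated

end Summit.HodgeConjecture.Ring2.NonCMFivefoldsCodimTwoResidualQuartic

end
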